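import Summits.NavierStokesRegularity.FunctionalMining.TopEigWeight
import Summits.NavierStokesRegularity.FunctionalMining.ConvexWeightViscous
import Summits.NavierStokesRegularity.FunctionalMining.StrainTensorTransport
import Summits.NavierStokesRegularity.FunctionalMining.StrainMomentRegBalance
import Summits.NavierStokesRegularity.FunctionalMining.C1WeightIntegralVec
import HarnessLib

/-!
# FunctionalMining — `Ḟ ≤ C M F` for the regularised moment `F = ∫ (φ̃ ⋆ g + 2r)(S)^q` of an admissible density `g`

Search for candidate a priori estimates; no regularity claim. Cell `pub-nsfunc`, prove seat
(gen 16). The differential inequality behind the K0 rows `ES.lam1.q|T_C|C1` / `ES.neglam3.q|T_C|C1`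
(`TopEigMomentRateSupBound`, `NegBotEigMomentRateSupBound`), for the REGULARISED weight `W_φ = g̃_φ^q`
of `TopEigWeight` (`g̃_φ = φ̃ ⋆ g + 2r`) built on an ADMISSIBLE density `g : ℝ^{3×3} → ℝ`: convex,
`1`-Lipschitz, and on the strains of smooth divergence-free fields non-negative and coercive
(`|S| ≤ 6 g(S)`) — e.g. `g = λ₁` and `g = −λ₃` (`TopEigRayleighSpectral`):
along a classical solution of unforced Navier–Stokes/Euler (`ν ≥ 0`) on `T³ × [a, b]` with
`|ω(τ,x)|² ≤ M²` throughout, `F_φ(s) = ∫ W_φ(S(u s))` has at every `τ` a one-sided derivative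
`D ≤ C M F_φ(τ)`, `C = q((6^q K₃)^{1/q} + (9^q C_P 6^q K₃)^{1/q})` — the constant of the `|S|^q`
rows (NOGO N8, `StrainMoment.reg_hasDerivWithinAt_le`) up to the coercivity factor `|S| ≤ 6g̃_φ(S)`.

Ingredients: `d/dt ∫ W(S) = ∫ DW(S)[∂ₜS]` (`C1Weight.hasDerivWithinAt_integral_comp_fderiv`);
`∂ₜS = νΔS − Π − N − (u·∇)S` (`StrainTensor.timeDerivWithin_strainFlat_eq`); viscous sign
`∫ DW(S)[ΔS] ≤ 0` (`ConvexWeight.integral_fderiv_laplacian_nonpos` + `TopEig.hessian_weight_nonneg`);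
transport `∫ DW(S)[(u·∇)S] = ∫ div(W(S)u) = 0`; productions `|DW(S)[Π + N]| ≤ q λ̃^{q−1}(h + g)`,
Hölder and the Calderón–Zygmund chain of N8 (`StrainMoment.holder_sup_chain`). [ours]
-/

noncomputable section

open MeasureTheory Set Filter Topology Finset
open scoped InnerProductSpace RealInnerProductSpace ContDiff

namespace Summit.NavierStokesRegularity.FunctionalMining

open Literature.Analysis.FunctionSpaces Literature.Analysis.FluidPDE

namespace TopEig

open StrainL4 StrainMoment VorticityL4 StrainTensor

/-! ## 1. Small calculus helpers -/

section Helpers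

variable {d : Type*} [Fintype d] [DecidableEq d]
variable {G : Type*} [NormedAddCommGroup G] [NormedSpace ℝ G]

/-- Chain rule on the torus: `∂ₖ(Φ ∘ θ)(x) = DΦ(θ x)[∂ₖθ x]` (`θ` of class `C¹`, `Φ` differentiable at
`θ x`). [folklore] -/
theorem partialDeriv_comp_eq_fderiv {Φ : G → ℝ} {θ : UnitAddTorus d → G} (hθ : Torus.IsContDiff 1 θ)
    (x : UnitAddTorus d) (hΦ : DifferentiableAt ℝ Φ (θ x)) (k : d) :
    Torus.partialDeriv k (fun y => Φ (θ y)) x = fderiv ℝ Φ (θ x) (Torus.partialDeriv k θ x) := by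
  have h1 := ConvexWeight.hasDerivAt_line k hθ x
  have h2 := hΦ.hasFDerivAt.comp_hasDerivAt_of_eq (0 : ℝ) h1 (by simp)
  rw [Torus.partialDeriv, Torus.lineDeriv]
  exact h2.deriv

/-- The flattened strain of the zero field vanishes. [ours] -/
theorem strainFlat_zero (x : UnitAddTorus d) :
    strainFlat (0 : UnitAddTorus d → EuclideanSpace ℝ d) x = 0 := by
  ext q
  simp [strainFlat_apply, Torus.partialDeriv, Torus.lineDeriv]

/-- `pressVec P` is smooth for smooth `P`. [ours] -/
theorem isSmooth_pressVec {P : UnitAddTorus d → ℝ} (hP : Torus.IsSmooth P) :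
    Torus.IsSmooth (pressVec P) :=
  EuclideanCoord.isSmooth_of_coord fun q => (hP.partialDeriv q.2).partialDeriv q.1

/-- `nonlinVec v` is smooth for smooth `v`. [ours] -/
theorem isSmooth_nonlinVec {v : UnitAddTorus d → EuclideanSpace ℝ d} (hv : Torus.IsSmooth v) :
    Torus.IsSmooth (nonlinVec v) := by
  refine EuclideanCoord.isSmooth_of_coord fun q => ?_
  have hc : ∀ i k, Torus.IsSmooth (fun y => Torus.partialDeriv i v y k) := fun i k =>
    (hv.partialDeriv i).apply k
  show Torus.IsSmooth (fun y => ((∑ k, Torus.partialDeriv q.2 v y k * Torus.partialDeriv k v y q.1) +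
    ∑ k, Torus.partialDeriv q.1 v y k * Torus.partialDeriv k v y q.2) / 2)
  exact ContDiff.div_const ((ContDiff.sum fun k _ => (hc q.2 k).mul (hc k q.1)).add
    (ContDiff.sum fun k _ => (hc q.1 k).mul (hc k q.2))) 2

end Helpers

/-! ## 2. The differential inequality -/

/-- **`Ḟ_φ ≤ C M F_φ` on a window with a uniform vorticity majorant** (module docstring). [ours] -/
theorem weight_hasDerivWithinAt_le {q : ℝ} (hq : 1 < q) {K₃ CP : ℝ} (hK₃0 : 0 ≤ K₃)
    (hK₃ : ∀ v : UnitAddTorus (Fin 3) → EuclideanSpace ℝ (Fin 3), Torus.IsSmooth v →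
      Torus.IsDivFree v → ∀ M : ℝ, 0 ≤ M → (∀ x, torusVorticitySqAt v x ≤ M ^ 2) →
        ∫ x, (∑ k, ‖Torus.partialDeriv k v x‖ ^ 2) ^ q ≤ K₃ * M ^ q * ∫ x, ‖strainFlat v x‖ ^ q)
    (hCP0 : 0 ≤ CP) {a b ν : ℝ} (hab : a < b) (hν : 0 ≤ ν)
    {u : ℝ → UnitAddTorus (Fin 3) → EuclideanSpace ℝ (Fin 3)} {p : ℝ → UnitAddTorus (Fin 3) → ℝ}
    (hsol : Torus.IsClassicalNSSolutionOn (Icc a b) ν 0 u p)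
    (hCP : ∀ t ∈ Icc a b, ∀ i j : Fin 3,
      ∫ x, |Torus.partialDeriv i (Torus.partialDeriv j (p t)) x| ^ q ≤
        CP * ∫ x, (∑ k, ‖Torus.partialDeriv k (u t) x‖ ^ 2) ^ q)
    {M : ℝ} (hM : 0 ≤ M) (hω : ∀ τ ∈ Icc a b, ∀ x, torusVorticitySqAt (u τ) x ≤ M ^ 2)
    {g : EuclideanSpace ℝ (Fin 3 × Fin 3) → ℝ} (hconv : ConvexOn ℝ univ g) (hlip : LipschitzWith 1 g)
    (hg0 : ∀ v : UnitAddTorus (Fin 3) → EuclideanSpace ℝ (Fin 3), Torus.IsSmooth v →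
      Torus.IsDivFree v → ∀ x, 0 ≤ g (strainFlat v x))
    (hg6 : ∀ v : UnitAddTorus (Fin 3) → EuclideanSpace ℝ (Fin 3), Torus.IsSmooth v →
      Torus.IsDivFree v → ∀ x, ‖strainFlat v x‖ ≤ 6 * g (strainFlat v x))
    (φ : ContDiffBump (0 : EuclideanSpace ℝ (Fin 3 × Fin 3))) {τ : ℝ} (hτ : τ ∈ Icc a b) :
    ∃ D : ℝ, HasDerivWithinAt (fun s => ∫ y, weight φ g q (strainFlat (u s) y)) D (Icc a b) τ ∧
      D ≤ q * ((((6 : ℝ) ^ q * K₃) ^ (1 / q)) + ((9 : ℝ) ^ q * CP * ((6 : ℝ) ^ q * K₃)) ^ (1 / q)) *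
        M * ∫ y, weight φ g q (strainFlat (u τ) y) := by
  have hq0 : 0 < q := by linarith
  have hq1 : (1 : ℝ) ≤ q := hq.le
  have hU : UniqueDiffOn ℝ (Icc a b) := uniqueDiffOn_Icc hab
  have hu : Torus.IsSmoothSpaceTimeOn (Icc a b) u := hsol.smooth_velocity
  have hut : Torus.IsSmooth (u τ) := hu.isSmooth_slice hτ
  have hu1 : Torus.IsContDiff 1 (u τ) := hut.isContDiff (by simp)
  have hdiv : Torus.IsDivFree (u τ) := hsol.divFree τ hτ
  have hpt : Torus.IsSmooth (p τ) := hsol.smooth_pressure.isSmooth_slice hτ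
  -- the packaged strain, the open set and the weight
  set Θ : ℝ → UnitAddTorus (Fin 3) → EuclideanSpace ℝ (Fin 3 × Fin 3) :=
    fun s y => strainFlat (u s) y with hΘdef
  have hΘ : Torus.IsSmoothSpaceTimeOn (Icc a b) Θ := isSmoothSpaceTimeOn_strainFlat hu hU
  have hΘt : Torus.IsSmooth (Θ τ) := isSmooth_strainFlat hut
  have hΘt1 : Torus.IsContDiff 1 (Θ τ) := hΘt.isContDiff (by simp)
  have hgc : Continuous g := hlip.continuous
  have hUo : IsOpen (posSet φ g) := isOpen_posSet φ hgc
  have hmaps : ∀ s ∈ Icc a b, ∀ y, Θ s y ∈ posSet φ g := fun s hs y =>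
    (mem_posSet_of_nonneg φ hlip (hg0 _ (hu.isSmooth_slice hs) (hsol.divFree s hs) y)).1
  have hmapsτ : ∀ y, Θ τ y ∈ posSet φ g := hmaps τ hτ
  set W : EuclideanSpace ℝ (Fin 3 × Fin 3) → ℝ := weight φ g q with hWdef
  have hW1 : ContDiffOn ℝ 1 W (posSet φ g) := contDiffOn_weight φ hgc q (by norm_cast)
  have hW2 : ContDiffOn ℝ 2 W (posSet φ g) := contDiffOn_weight φ hgc q (by norm_cast)
  have hWd : ∀ y, DifferentiableAt ℝ W (Θ τ y) := fun y =>
    ((hW1.differentiableOn (by simp)).differentiableAt (hUo.mem_nhds (hmapsτ y)))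
  -- Step 1: differentiate under the integral sign
  have hD := C1Weight.hasDerivWithinAt_integral_comp_fderiv hab hΘ hUo hW1 hmaps hτ
  refine ⟨_, hD, ?_⟩
  -- names for the densities
  set ρ : UnitAddTorus (Fin 3) → ℝ := fun y => lamReg φ g (Θ τ y) with hρdef
  set gd : UnitAddTorus (Fin 3) → ℝ := fun y => ∑ k, ‖Torus.partialDeriv k (u τ) y‖ ^ 2 with hgddef
  set h : UnitAddTorus (Fin 3) → ℝ := fun y =>
    ∑ i, ∑ j, |Torus.partialDeriv i (Torus.partialDeriv j (p τ)) y| with hhdef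
  have hρpos : ∀ y, 0 < ρ y := fun y => hmapsτ y
  have hρc : Continuous ρ := (contDiff_lamReg φ hgc).continuous.comp hΘt.continuous
  have hgdc : Continuous gd := continuous_gradSq hut
  have hhc : Continuous h := continuous_hessAbs hpt
  have hgd0 : ∀ y, 0 ≤ gd y := fun y => Finset.sum_nonneg fun k _ => sq_nonneg _
  have hh0 : ∀ y, 0 ≤ h y := fun y =>
    Finset.sum_nonneg fun i _ => Finset.sum_nonneg fun j _ => abs_nonneg _
  have hWρ : ∀ y, W (Θ τ y) = ρ y ^ q := fun y => rfl
  obtain ⟨F, hF⟩ : ∃ F : ℝ, F = ∫ y, W (Θ τ y) := ⟨_, rfl⟩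
  have hF0 : 0 ≤ F := by rw [hF]; exact integral_nonneg fun y => weight_nonneg φ q (hmapsτ y)
  have hFρ : ∫ y, ρ y ^ q = F := by rw [hF]; rfl
  -- the four pieces of `DW(S)[∂ₜS]`
  set A : UnitAddTorus (Fin 3) → ℝ := fun y =>
    fderiv ℝ W (Θ τ y) (Torus.laplacian (Θ τ) y) with hAdef
  set Pp : UnitAddTorus (Fin 3) → ℝ := fun y => fderiv ℝ W (Θ τ y) (pressVec (p τ) y) with hPdef
  set Nn : UnitAddTorus (Fin 3) → ℝ := fun y => fderiv ℝ W (Θ τ y) (nonlinVec (u τ) y) with hNdef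
  set B : UnitAddTorus (Fin 3) → ℝ := fun y =>
    fderiv ℝ W (Θ τ y) (∑ k, u τ y k • Torus.partialDeriv k (Θ τ) y) with hBdef
  have hsplit : ∀ y, fderiv ℝ W (Θ τ y) (Torus.timeDerivWithin (Icc a b) Θ τ y) =
      ν * A y - Pp y - Nn y - B y := by
    intro y
    rw [show Torus.timeDerivWithin (Icc a b) Θ τ y =
        Torus.timeDerivWithin (Icc a b) (fun s z => strainFlat (u s) z) τ y from rfl,
      timeDerivWithin_strainFlat_eq hsol hab hτ y]
    simp only [hAdef, hPdef, hNdef, hBdef, map_sub, map_smul, smul_eq_mul,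
      show (0 : ℝ → UnitAddTorus (Fin 3) → EuclideanSpace ℝ (Fin 3)) τ = 0 from rfl,
      strainFlat_zero, add_zero]
    rfl
  -- continuity of the pieces
  have hcA : Continuous A :=
    ConvexWeight.continuous_fderiv_apply hUo hW2 hΘt hmapsτ hΘt.laplacian.continuous
  have hcP : Continuous Pp :=
    ConvexWeight.continuous_fderiv_apply hUo hW2 hΘt hmapsτ (isSmooth_pressVec hpt).continuous
  have hcN : Continuous Nn :=
    ConvexWeight.continuous_fderiv_apply hUo hW2 hΘt hmapsτ (isSmooth_nonlinVec hut).continuous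
  have hcB : Continuous B := by
    refine ConvexWeight.continuous_fderiv_apply hUo hW2 hΘt hmapsτ ?_
    exact continuous_finsetSum _ fun k _ =>
      ((hut.apply k).continuous).smul (hΘt.partialDeriv k).continuous
  -- Step 2: the viscous piece is `≤ 0`
  have hA : ∫ y, A y ≤ 0 :=
    ConvexWeight.integral_fderiv_laplacian_nonpos hUo hW2 hΘt hmapsτ
      fun y w => hessian_weight_nonneg φ hconv hlip hq1 (hmapsτ y) w
  -- Step 3: the transport piece integrates to zero
  have hB : ∫ y, B y = 0 := by
    set gW : UnitAddTorus (Fin 3) → ℝ := fun y => W (Θ τ y) with hgW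
    have hgW1 : Torus.IsContDiff 1 gW := by
      unfold Torus.IsContDiff
      exact hW1.comp_contDiff hΘt1 fun x => hmapsτ _
    have hgk : ∀ k y, Torus.partialDeriv k gW y = fderiv ℝ W (Θ τ y) (Torus.partialDeriv k (Θ τ) y) :=
      fun k y => partialDeriv_comp_eq_fderiv hΘt1 y (hWd y) k
    have hpt' : ∀ y, B y = Torus.divergence (fun z => gW z • u τ z) y := by
      intro y
      rw [Torus.divergence_smul hgW1 hu1 y, hdiv y, mul_zero, zero_add, hBdef]
      simp only [map_sum, map_smul, smul_eq_mul, hgk]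
    simp_rw [hpt']
    have hgu : Torus.IsContDiff 1 (fun z => gW z • u τ z) := by
      unfold Torus.IsContDiff at hgW1 hu1 ⊢
      exact hgW1.smul hu1
    exact Torus.integral_divergence_eq_zero_of_isContDiff hgu
  -- Step 4: the productions
  have hGle : ∫ y, gd y ^ q ≤ (6 : ℝ) ^ q * K₃ * M ^ q * F := by
    have h1 : ∫ y, gd y ^ q ≤ K₃ * M ^ q * ∫ y, ‖strainFlat (u τ) y‖ ^ q :=
      hK₃ (u τ) hut hdiv M hM (hω τ hτ)
    have h2 : ∫ y, ‖strainFlat (u τ) y‖ ^ q ≤ (6 : ℝ) ^ q * F := by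
      rw [← hFρ, ← integral_const_mul]
      refine integral_mono_of_nonneg (ae_of_all _ fun y => Real.rpow_nonneg (norm_nonneg _) _)
        ((hρc.rpow_const fun y => Or.inr hq0.le).const_mul _ |>.integrable_unitAddTorus)
        (ae_of_all _ fun y => ?_)
      show ‖strainFlat (u τ) y‖ ^ q ≤ (6 : ℝ) ^ q * ρ y ^ q
      rw [← Real.mul_rpow (by norm_num) (hρpos y).le]
      exact Real.rpow_le_rpow (norm_nonneg _)
        (le_mul_lamReg_of_le_mul φ hlip (by norm_num) (hg6 _ hut hdiv y)) hq0.le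
    calc ∫ y, gd y ^ q ≤ K₃ * M ^ q * ∫ y, ‖strainFlat (u τ) y‖ ^ q := h1
      _ ≤ K₃ * M ^ q * ((6 : ℝ) ^ q * F) :=
          mul_le_mul_of_nonneg_left h2 (mul_nonneg hK₃0 (Real.rpow_nonneg hM _))
      _ = (6 : ℝ) ^ q * K₃ * M ^ q * F := by ring
  have h6K : 0 ≤ (6 : ℝ) ^ q * K₃ := mul_nonneg (Real.rpow_nonneg (by norm_num) _) hK₃0
  have hG0 : 0 ≤ ∫ y, gd y ^ q := integral_nonneg fun y => Real.rpow_nonneg (hgd0 y) _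
  have hH0 : 0 ≤ ∫ y, h y ^ q := integral_nonneg fun y => Real.rpow_nonneg (hh0 y) _
  -- |∫ DW[X]| ≤ q ∫ ρ^{q-1} b whenever ‖X‖ ≤ b pointwise
  have hprod : ∀ {X : UnitAddTorus (Fin 3) → EuclideanSpace ℝ (Fin 3 × Fin 3)}
      {bX : UnitAddTorus (Fin 3) → ℝ}, Continuous (fun y => fderiv ℝ W (Θ τ y) (X y)) →
      Continuous bX → (∀ y, ‖X y‖ ≤ bX y) →
      |∫ y, fderiv ℝ W (Θ τ y) (X y)| ≤ q * ∫ y, ρ y ^ (q - 1) * bX y := by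
    intro X bX hcX hcb hXb
    have hpt : ∀ y, |fderiv ℝ W (Θ τ y) (X y)| ≤ q * (ρ y ^ (q - 1) * bX y) := fun y =>
      calc |fderiv ℝ W (Θ τ y) (X y)| ≤ q * lamReg φ g (Θ τ y) ^ (q - 1) * ‖X y‖ :=
            abs_fderiv_weight_apply_le φ hlip hq0.le (hmapsτ y) (X y)
        _ ≤ q * lamReg φ g (Θ τ y) ^ (q - 1) * bX y :=
            mul_le_mul_of_nonneg_left (hXb y)
              (mul_nonneg hq0.le (Real.rpow_nonneg (hρpos y).le _))
        _ = q * (ρ y ^ (q - 1) * bX y) := by ring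
    have hc : Continuous fun y => q * (ρ y ^ (q - 1) * bX y) :=
      continuous_const.mul ((hρc.rpow_const fun y => Or.inl (hρpos y).ne').mul hcb)
    calc |∫ y, fderiv ℝ W (Θ τ y) (X y)| ≤ ∫ y, |fderiv ℝ W (Θ τ y) (X y)| :=
          abs_integral_le_integral_abs
      _ ≤ ∫ y, q * (ρ y ^ (q - 1) * bX y) :=
          integral_mono_of_nonneg (ae_of_all _ fun y => abs_nonneg _) hc.integrable_unitAddTorus
            (ae_of_all _ hpt)
      _ = q * ∫ y, ρ y ^ (q - 1) * bX y := integral_const_mul _ _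
  have hNle : |∫ y, Nn y| ≤ q * (((6 : ℝ) ^ q * K₃) ^ (1 / q) * M * F) := by
    have h1 := hprod hcN hgdc (fun y => norm_nonlinVec_le (u τ) y)
    have h2 := integral_rpow_mul_le_holder hρc hgdc (fun y => (hρpos y).le) hgd0 hq
    rw [hFρ] at h2
    have h3 := holder_sup_chain hF0 hG0 h6K hM hq0 h2 hGle
    exact h1.trans (mul_le_mul_of_nonneg_left h3 hq0.le)
  have hHle : ∫ y, h y ^ q ≤ (9 : ℝ) ^ q * CP * ((6 : ℝ) ^ q * K₃) * M ^ q * F := by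
    have hH := integral_sum_abs_rpow_le (d := Fin 3)
      (H := fun i j x => Torus.partialDeriv i (Torus.partialDeriv j (p τ)) x)
      (fun i j => ((hpt.partialDeriv j).partialDeriv i).continuous) hq1
    simp only [Fintype.card_fin, Nat.cast_ofNat] at hH
    have hsum : ∑ i : Fin 3, ∑ j : Fin 3,
        ∫ x, |Torus.partialDeriv i (Torus.partialDeriv j (p τ)) x| ^ q ≤
        ∑ _i : Fin 3, ∑ _j : Fin 3, CP * ∫ y, gd y ^ q :=
      Finset.sum_le_sum fun i _ => Finset.sum_le_sum fun j _ => hCP τ hτ i j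
    have hsum' : ∑ _i : Fin 3, ∑ _j : Fin 3, CP * ∫ y, gd y ^ q = 9 * (CP * ∫ y, gd y ^ q) := by
      simp only [Finset.sum_const, Finset.card_univ, Fintype.card_fin]
      ring
    have h9' : ((3 : ℝ) ^ 2) ^ (q - 1) * 9 = (9 : ℝ) ^ q := by
      rw [show (3 : ℝ) ^ 2 = 9 by norm_num, Real.rpow_sub (by norm_num : (0 : ℝ) < 9),
        Real.rpow_one]
      field_simp
    have h9q : 0 ≤ ((3 : ℝ) ^ 2) ^ (q - 1) := Real.rpow_nonneg (by norm_num) _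
    calc ∫ y, h y ^ q ≤ ((3 : ℝ) ^ 2) ^ (q - 1) *
          ∑ i : Fin 3, ∑ j : Fin 3, ∫ x, |Torus.partialDeriv i (Torus.partialDeriv j (p τ)) x| ^ q := hH
      _ ≤ ((3 : ℝ) ^ 2) ^ (q - 1) * (9 * (CP * ∫ y, gd y ^ q)) := by
          rw [← hsum']; exact mul_le_mul_of_nonneg_left hsum h9q
      _ ≤ ((3 : ℝ) ^ 2) ^ (q - 1) * (9 * (CP * ((6 : ℝ) ^ q * K₃ * M ^ q * F))) := by gcongr
      _ = (((3 : ℝ) ^ 2) ^ (q - 1) * 9) * CP * ((6 : ℝ) ^ q * K₃) * M ^ q * F := by ring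
      _ = (9 : ℝ) ^ q * CP * ((6 : ℝ) ^ q * K₃) * M ^ q * F := by rw [h9']
  have h9 : 0 ≤ (9 : ℝ) ^ q * CP * ((6 : ℝ) ^ q * K₃) := by positivity
  have hPle : |∫ y, Pp y| ≤ q * (((9 : ℝ) ^ q * CP * ((6 : ℝ) ^ q * K₃)) ^ (1 / q) * M * F) := by
    have h1 := hprod hcP hhc (fun y => norm_pressVec_le (p τ) y)
    have h2 := integral_rpow_mul_le_holder hρc hhc (fun y => (hρpos y).le) hh0 hq
    rw [hFρ] at h2
    have h3 := holder_sup_chain hF0 hH0 h9 hM hq0 h2 hHle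
    exact h1.trans (mul_le_mul_of_nonneg_left h3 hq0.le)
  -- Step 5: assemble
  have hval : (∫ y, fderiv ℝ W (Θ τ y) (Torus.timeDerivWithin (Icc a b) Θ τ y)) =
      ν * (∫ y, A y) - (∫ y, Pp y) - (∫ y, Nn y) - ∫ y, B y := by
    simp_rw [hsplit]
    have hiA : Integrable (fun y => ν * A y) := (continuous_const.mul hcA).integrable_unitAddTorus
    have hiP := hcP.integrable_unitAddTorus
    have hiN := hcN.integrable_unitAddTorus
    have hiB := hcB.integrable_unitAddTorus
    have hi2 : Integrable (fun y => ν * A y - Pp y) := hiA.sub hiP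
    have hi3 : Integrable (fun y => ν * A y - Pp y - Nn y) := hi2.sub hiN
    rw [integral_sub hi3 hiB, integral_sub hi2 hiN, integral_sub hiA hiP, integral_const_mul]
  rw [hval, hB, ← hF]
  have hνA : ν * ∫ y, A y ≤ 0 := mul_nonpos_of_nonneg_of_nonpos hν hA
  have hP' : -(∫ y, Pp y) ≤ |∫ y, Pp y| := neg_le_abs _
  have hN' : -(∫ y, Nn y) ≤ |∫ y, Nn y| := neg_le_abs _
  nlinarith [hNle, hPle, hP', hN', hνA, hF0, hM]

end TopEig

end Summit.NavierStokesRegularity.FunctionalMining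

end
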